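import Mathlib
import Summits.NavierStokesRegularity.NavierStokesRegularity.Theorems.PlaneEnergyCeilingSlabEnergyIdentitySlab

/-!
# Crux `PlanarEnergyAPriori` (stmt-NavierStokesRegularity-16855), route PlaneEnergyCeiling:
  a planar energy ceiling bounds the scale-invariant Hardy energy (kinematic transfer)

Helper file for the crux item stmt-NavierStokesRegularity-16855
(`Summit.NavierStokesRegularity.NavierStokesRegularity.Theses.PlaneEnergyCeiling.PlanarEnergyAPriori`).

**Main result** (`lintegral_div_enorm_sub_le_of_planar`). Let `g : ℝ³ → ℝ≥0∞` be measurable and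
suppose every planar integral of `g` is at most `X`:
`∫_{ℝ²} g (R (y₀, y₁, c)) dy ≤ X` for all linear isometries `R` of `ℝ³` and all heights `c` (the
plane family of the route file). Then for every centre `x₀`,

  `∫_{ℝ³} g(x) / |x − x₀| dx ≤ 2π · X`.

With `g = |u(t)|²` this says: a planar kinetic-energy ceiling `M` bounds the scale-invariant Hardy
energy `∫ |u|²/|x − x₀|` of crux C2 of route HardyPointSink (`Theses.HardyPointSink.HardyEnergyBound`)
by `2πM`, uniformly in the sink `x₀` — the "Fuglede average" of the crux workfiles
(`Cruxes/PlanarEnergyAPriori/Ideas/hardy-average-transfer.md`, first lemma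
`PlanarCeilingImpliesHardy`; STRATEGY-CENSUS gen 1, A-D7 (ii)).

**Proof** (pencil of planes through the vertical axis at `x₀`; no surface measure is needed).
Translate `x₀` to the origin (the plane family is translation invariant, Lebesgue measure on `ℝ²`
is translation invariant). Since `|x| ≥ |x'|`, `x' = (x₀, x₁)` the horizontal part,
`∫ g/|x| ≤ ∫ g(x)/|x'| dx = ∫_h ∫_{ℝ²} g(y', h)/|y'| dy' dh` (Fubini through the slab chart of
`Theorems/PlaneEnergyCeilingSlabEnergyIdentitySlab.lean`). In polar coordinates in the horizontal
plane (Mathlib `lintegral_comp_polarCoord_symm`) the weight `1/|y'|` cancels the Jacobian `r`: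
`∫_{ℝ²} g(y',h)/|y'| dy' = ∫_{θ ∈ (−π,π)} ∫_{r>0} g(r cos θ, r sin θ, h) dr dθ`. Swapping the
`h`- and `θ`-integrals, the inner double integral over the HALF-plane `{r > 0}` is at most the
integral of `g` over the full vertical plane through the axis with direction `θ`, which is the
plane `R_θ({x₂ = 0})` for the explicit linear isometry
`R_θ (a, b, c) = (a cos θ − c sin θ, a sin θ + c cos θ, b)`; hence it is `≤ X`, and integrating the
constant over `θ ∈ (−π, π)` gives `2πX`.

Contents:
* `exists_planeChart'` (private) — `ℝ × ℝ ≃ᵐ ℝ²`, measure preserving, `(a, b) ↦ (a, b)`;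
* `exists_tilt` — the isometry `R_θ` above (constructed inside the proof, no definitions);
* `planarBound_translate` — the planar bound is invariant under translating `g`;
* `lintegral_div_enorm_le_of_planar` (centre `0`) and `lintegral_div_enorm_sub_le_of_planar`
  (any centre): the transfer inequality with constant `2π`.

Elementary real analysis (Tonelli, polar coordinates, translation invariance); no fluid
mechanics enters.
-/

noncomputable section

-- Problem = summit for this single-conjunct summit: the duplicate namespace component is deliberate.
set_option linter.dupNamespace false

namespace Summit.NavierStokesRegularity.NavierStokesRegularity.Theorems.PlanarEnergyAPriori

open MeasureTheory Set Filter Topology WithLp Real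
open scoped ENNReal
open PlaneEnergyCeilingSlabEnergyIdentity (exists_slabChart)

/-! ### Charts and continuity of the coordinate parametrisations -/

/-- **The plane chart.** A measurable equivalence `e : ℝ × ℝ ≃ᵐ ℝ²` with `e (a, b) = (a, b)`
preserving Lebesgue measure (`finTwoArrow⁻¹` followed by `toLp`). (Private copy of the identical
lemma of `Theorems/PlaneEnergyCeilingPlanarEnergyAPrioriLadyzhenskaya.lean`, to keep this kinematic
file on light imports.) -/
private theorem exists_planeChart' : ∃ e : ℝ × ℝ ≃ᵐ EuclideanSpace ℝ (Fin 2),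
    MeasurePreserving e volume volume ∧ ∀ a b : ℝ, e (a, b) = toLp 2 ![a, b] := by
  refine ⟨(MeasurableEquiv.finTwoArrow (α := ℝ)).symm.trans (MeasurableEquiv.toLp 2 (Fin 2 → ℝ)),
    ?_, ?_⟩
  · exact (volume_preserving_finTwoArrow ℝ).symm.trans (PiLp.volume_preserving_toLp (Fin 2))
  · intro a b
    ext k
    fin_cases k <;> rfl

/-- Continuity of `a ↦ (f₀ a, f₁ a, f₂ a) ∈ ℝ³` for continuous coordinate functions. -/
theorem continuous_toLp_vec3 {α : Type*} [TopologicalSpace α] {f₀ f₁ f₂ : α → ℝ}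
    (h₀ : Continuous f₀) (h₁ : Continuous f₁) (h₂ : Continuous f₂) :
    Continuous fun a => (toLp 2 ![f₀ a, f₁ a, f₂ a] : EuclideanSpace ℝ (Fin 3)) := by
  refine (PiLp.continuous_toLp 2 (fun _ : Fin 3 => ℝ)).comp (continuous_pi fun i => ?_)
  fin_cases i
  · simpa using h₀
  · simpa using h₁
  · simpa using h₂

/-- Continuity of `a ↦ (f₀ a, f₁ a) ∈ ℝ²` for continuous coordinate functions. -/
theorem continuous_toLp_vec2 {α : Type*} [TopologicalSpace α] {f₀ f₁ : α → ℝ}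
    (h₀ : Continuous f₀) (h₁ : Continuous f₁) :
    Continuous fun a => (toLp 2 ![f₀ a, f₁ a] : EuclideanSpace ℝ (Fin 2)) := by
  refine (PiLp.continuous_toLp 2 (fun _ : Fin 2 => ℝ)).comp (continuous_pi fun i => ?_)
  fin_cases i
  · simpa using h₀
  · simpa using h₁

/-! ### The vertical pencil of planes: the isometries `R_θ` -/

/-- **The isometry `R_θ`** of `ℝ³` carrying the coordinate plane `{x₂ = 0}` onto the vertical plane
through the `e₂`-axis with horizontal direction `(cos θ, sin θ, 0)`: there is a linear isometry `R`
with `R (a, b, 0) = (a cos θ, a sin θ, b)` (namely `R (a, b, c) = (a cos θ − c sin θ, a sin θ + c cos θ, b)`,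
rotation by `θ` in the `(e₀, e₂)`-plane followed by the swap `e₁ ↔ e₂`; built inside the proof). -/
theorem exists_tilt (θ : ℝ) :
    ∃ R : EuclideanSpace ℝ (Fin 3) ≃ₗᵢ[ℝ] EuclideanSpace ℝ (Fin 3),
      ∀ a b : ℝ, R (toLp 2 ![a, b, 0]) = toLp 2 ![a * cos θ, a * sin θ, b] := by
  let L : EuclideanSpace ℝ (Fin 3) →ₗ[ℝ] EuclideanSpace ℝ (Fin 3) :=
    { toFun := fun x => toLp 2 ![x 0 * cos θ - x 2 * sin θ, x 0 * sin θ + x 2 * cos θ, x 1]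
      map_add' := fun x y => by
        ext i
        fin_cases i <;> simp <;> ring
      map_smul' := fun c x => by
        ext i
        fin_cases i <;> simp <;> ring }
  have hLapply : ∀ x : EuclideanSpace ℝ (Fin 3),
      L x = toLp 2 ![x 0 * cos θ - x 2 * sin θ, x 0 * sin θ + x 2 * cos θ, x 1] := fun x => rfl
  have hL : ∀ x, ‖L x‖ = ‖x‖ := by
    intro x
    rw [EuclideanSpace.norm_eq, EuclideanSpace.norm_eq]
    congr 1
    simp only [Fin.sum_univ_three, Real.norm_eq_abs, sq_abs, hLapply]
    simp
    nlinarith [sin_sq_add_cos_sq θ]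
  refine ⟨({ L with norm_map' := hL } :
    EuclideanSpace ℝ (Fin 3) →ₗᵢ[ℝ] EuclideanSpace ℝ (Fin 3)).toLinearIsometryEquiv rfl, fun a b => ?_⟩
  rw [LinearIsometry.toLinearIsometryEquiv_apply]
  change L (toLp 2 ![a, b, 0]) = _
  rw [hLapply]
  congr 1
  ext i
  fin_cases i <;> simp

/-! ### Translation invariance of the planar bound -/

/-- Translating the plane parametrisation: `R (y₀, y₁, c) + x₀ = R (y₀ + v₀, y₁ + v₁, c + v₂)` with
`v = R⁻¹ x₀`. -/
theorem isometry_toLp_vec3_add (R : EuclideanSpace ℝ (Fin 3) ≃ₗᵢ[ℝ] EuclideanSpace ℝ (Fin 3))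
    (x₀ : EuclideanSpace ℝ (Fin 3)) (y : EuclideanSpace ℝ (Fin 2)) (c : ℝ) :
    R (toLp 2 ![y 0, y 1, c]) + x₀ =
      R (toLp 2 ![(toLp 2 ![R.symm x₀ 0, R.symm x₀ 1] + y) 0,
        (toLp 2 ![R.symm x₀ 0, R.symm x₀ 1] + y) 1, c + R.symm x₀ 2]) := by
  conv_lhs => rw [← R.apply_symm_apply x₀]
  rw [← map_add]
  congr 1
  ext i
  fin_cases i <;> simp [add_comm]

/-- **The planar bound is translation invariant.** If every planar integral of `g` is `≤ X`, the
same holds for `g (· + x₀)` (Lebesgue measure on `ℝ²` is translation invariant). -/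
theorem planarBound_translate {g : EuclideanSpace ℝ (Fin 3) → ℝ≥0∞} {X : ℝ≥0∞}
    (hX : ∀ (R : EuclideanSpace ℝ (Fin 3) ≃ₗᵢ[ℝ] EuclideanSpace ℝ (Fin 3)) (c : ℝ),
      ∫⁻ y : EuclideanSpace ℝ (Fin 2), g (R (toLp 2 ![y 0, y 1, c])) ≤ X)
    (x₀ : EuclideanSpace ℝ (Fin 3)) :
    ∀ (R : EuclideanSpace ℝ (Fin 3) ≃ₗᵢ[ℝ] EuclideanSpace ℝ (Fin 3)) (c : ℝ),
      ∫⁻ y : EuclideanSpace ℝ (Fin 2), g (R (toLp 2 ![y 0, y 1, c]) + x₀) ≤ X := by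
  intro R c
  set a : EuclideanSpace ℝ (Fin 2) := toLp 2 ![R.symm x₀ 0, R.symm x₀ 1] with ha
  set F : EuclideanSpace ℝ (Fin 2) → ℝ≥0∞ :=
    fun z => g (R (toLp 2 ![z 0, z 1, c + R.symm x₀ 2])) with hF
  have key : (fun y : EuclideanSpace ℝ (Fin 2) => g (R (toLp 2 ![y 0, y 1, c]) + x₀)) =
      fun y => F (a + y) := by
    funext y
    simp only [hF, ha]
    rw [isometry_toLp_vec3_add]
  have hinv : ∫⁻ y, F (a + y) = ∫⁻ y, F y := lintegral_add_left_eq_self F a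
  rw [key, hinv]
  exact hX R (c + R.symm x₀ 2)

/-! ### The transfer inequality -/

/-- The horizontal radius is at most the full radius: `√(x₀² + x₁²) ≤ |x|` in `ℝ≥0∞`. -/
theorem ofReal_sqrt_sq_add_sq_le_enorm (x : EuclideanSpace ℝ (Fin 3)) :
    ENNReal.ofReal (Real.sqrt (x 0 ^ 2 + x 1 ^ 2)) ≤ ‖x‖ₑ := by
  rw [← ofReal_norm]
  refine ENNReal.ofReal_le_ofReal ?_
  rw [EuclideanSpace.norm_eq]
  refine Real.sqrt_le_sqrt ?_
  simp only [Fin.sum_univ_three, Real.norm_eq_abs, sq_abs]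
  nlinarith [sq_nonneg (x 2)]

/-- In polar coordinates the horizontal radius of `(r cos θ, r sin θ)` is `r` (`r > 0`). -/
theorem sqrt_sq_add_sq_polar {r : ℝ} (hr : 0 < r) (θ : ℝ) :
    Real.sqrt ((r * cos θ) ^ 2 + (r * sin θ) ^ 2) = r := by
  have h : (r * cos θ) ^ 2 + (r * sin θ) ^ 2 = r ^ 2 := by
    nlinarith [sin_sq_add_cos_sq θ]
  rw [h, Real.sqrt_sq hr.le]

/-- **Planar ceiling ⇒ Hardy ceiling, centre at the origin.** If `g : ℝ³ → ℝ≥0∞` is measurable and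
all its planar integrals are `≤ X`, then `∫ g(x)/|x| dx ≤ 2π X`. -/
theorem lintegral_div_enorm_le_of_planar {g : EuclideanSpace ℝ (Fin 3) → ℝ≥0∞} (hg : Measurable g)
    {X : ℝ≥0∞}
    (hX : ∀ (R : EuclideanSpace ℝ (Fin 3) ≃ₗᵢ[ℝ] EuclideanSpace ℝ (Fin 3)) (c : ℝ),
      ∫⁻ y : EuclideanSpace ℝ (Fin 2), g (R (toLp 2 ![y 0, y 1, c])) ≤ X) :
    ∫⁻ x, g x / ‖x‖ₑ ≤ ENNReal.ofReal (2 * π) * X := by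
  obtain ⟨e, he, heq⟩ := exists_slabChart
  obtain ⟨e₂, he₂, heq₂⟩ := exists_planeChart'
  -- the weighted integrand with the horizontal radius
  set G : EuclideanSpace ℝ (Fin 3) → ℝ≥0∞ :=
    fun x => g x / ENNReal.ofReal (Real.sqrt (x 0 ^ 2 + x 1 ^ 2)) with hG
  have hrad : Continuous fun x : EuclideanSpace ℝ (Fin 3) => Real.sqrt (x 0 ^ 2 + x 1 ^ 2) := by
    fun_prop
  have hGm : Measurable G := hg.div (ENNReal.measurable_ofReal.comp hrad.measurable)
  -- the integrand in the coordinates `(h, r, θ)`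
  set H : ℝ × (ℝ × ℝ) → ℝ≥0∞ :=
    fun z => g (toLp 2 ![z.2.1 * cos z.2.2, z.2.1 * sin z.2.2, z.1]) with hH
  have hHm : Measurable H := by
    refine hg.comp (continuous_toLp_vec3 ?_ ?_ continuous_fst).measurable
    · exact (continuous_fst.comp continuous_snd).mul
        (continuous_cos.comp (continuous_snd.comp continuous_snd))
    · exact (continuous_fst.comp continuous_snd).mul
        (continuous_sin.comp (continuous_snd.comp continuous_snd))
  -- ### Step 1: `|x| ≥ |x'|`
  have h1 : ∫⁻ x, g x / ‖x‖ₑ ≤ ∫⁻ x, G x :=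
    lintegral_mono fun x => ENNReal.div_le_div_left (ofReal_sqrt_sq_add_sq_le_enorm x) _
  refine h1.trans ?_
  -- ### Step 2: Fubini through the slab chart, heights outside
  have h2 : ∫⁻ x, G x = ∫⁻ h : ℝ, ∫⁻ y : EuclideanSpace ℝ (Fin 2), G (toLp 2 ![y 0, y 1, h]) := by
    rw [← he.lintegral_comp_emb e.measurableEmbedding, Measure.volume_eq_prod,
      lintegral_prod (fun z : ℝ × EuclideanSpace ℝ (Fin 2) => G (e z))
        ((hGm.comp e.measurable).aemeasurable)]
    simp only [heq]
  rw [h2]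
  -- ### Step 3: polar coordinates in each horizontal plane
  have h3 : ∀ h : ℝ, ∫⁻ y : EuclideanSpace ℝ (Fin 2), G (toLp 2 ![y 0, y 1, h]) =
      ∫⁻ p in polarCoord.target, H (h, p) := by
    intro h
    -- to `ℝ × ℝ`
    have hstep : ∫⁻ y : EuclideanSpace ℝ (Fin 2), G (toLp 2 ![y 0, y 1, h]) =
        ∫⁻ q : ℝ × ℝ, G (toLp 2 ![q.1, q.2, h]) := by
      rw [← he₂.lintegral_comp_emb e₂.measurableEmbedding]
      congr 1
      ext q
      rcases q with ⟨a, b⟩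
      simp [heq₂]
    rw [hstep, ← lintegral_comp_polarCoord_symm]
    refine setLIntegral_congr_fun polarCoord.open_target.measurableSet fun p hp => ?_
    have hr : 0 < p.1 := hp.1
    simp only [hG, hH, polarCoord_symm_apply, smul_eq_mul]
    have hc : (toLp 2 ![p.1 * cos p.2, p.1 * sin p.2, h] : EuclideanSpace ℝ (Fin 3)) 0 ^ 2 +
        (toLp 2 ![p.1 * cos p.2, p.1 * sin p.2, h] : EuclideanSpace ℝ (Fin 3)) 1 ^ 2 =
        (p.1 * cos p.2) ^ 2 + (p.1 * sin p.2) ^ 2 := by rfl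
    rw [hc, sqrt_sq_add_sq_polar hr]
    exact ENNReal.mul_div_cancel (ENNReal.ofReal_pos.2 hr).ne' ENNReal.ofReal_ne_top
  simp_rw [h3]
  -- ### Step 4: swap the height and the polar variables
  have h4 : ∫⁻ h : ℝ, ∫⁻ p in polarCoord.target, H (h, p) =
      ∫⁻ p in polarCoord.target, ∫⁻ h : ℝ, H (h, p) :=
    lintegral_lintegral_swap (hHm.aemeasurable)
  rw [h4]
  have htarget : (volume.restrict polarCoord.target : Measure (ℝ × ℝ)) =
      (volume.restrict (Ioi (0 : ℝ))).prod (volume.restrict (Ioo (-π) π)) := by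
    rw [polarCoord_target, Measure.volume_eq_prod, Measure.prod_restrict]
  have h5 : ∫⁻ p in polarCoord.target, ∫⁻ h : ℝ, H (h, p) =
      ∫⁻ θ in Ioo (-π) π, ∫⁻ r in Ioi (0 : ℝ), ∫⁻ h : ℝ, H (h, (r, θ)) := by
    rw [htarget, lintegral_prod_symm]
    exact (hHm.lintegral_prod_left').aemeasurable
  rw [h5]
  -- ### Step 5: each half-plane integral is at most a planar integral `≤ X`
  have h6 : ∀ θ : ℝ, ∫⁻ r in Ioi (0 : ℝ), ∫⁻ h : ℝ, H (h, (r, θ)) ≤ X := by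
    intro θ
    obtain ⟨Rθ, hRθ⟩ := exists_tilt θ
    calc ∫⁻ r in Ioi (0 : ℝ), ∫⁻ h : ℝ, H (h, (r, θ))
        ≤ ∫⁻ r : ℝ, ∫⁻ h : ℝ, H (h, (r, θ)) := setLIntegral_le_lintegral _ _
      _ = ∫⁻ q : ℝ × ℝ, H (q.2, (q.1, θ)) := by
          rw [Measure.volume_eq_prod, lintegral_prod]
          exact (hHm.comp (by fun_prop : Measurable fun q : ℝ × ℝ => (q.2, (q.1, θ)))).aemeasurable
      _ = ∫⁻ y : EuclideanSpace ℝ (Fin 2), g (Rθ (toLp 2 ![y 0, y 1, 0])) := by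
          rw [← he₂.lintegral_comp_emb e₂.measurableEmbedding]
          congr 1
          ext q
          rcases q with ⟨a, b⟩
          simp [hH, heq₂, hRθ]
      _ ≤ X := hX Rθ 0
  -- ### Step 6: integrate the constant over `θ ∈ (−π, π)`
  calc ∫⁻ θ in Ioo (-π) π, ∫⁻ r in Ioi (0 : ℝ), ∫⁻ h : ℝ, H (h, (r, θ))
      ≤ ∫⁻ θ in Ioo (-π) π, X := lintegral_mono fun θ => h6 θ
    _ = ENNReal.ofReal (2 * π) * X := by
        rw [setLIntegral_const, Real.volume_Ioo, mul_comm]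
        congr 2
        ring

/-- **Planar ceiling ⇒ Hardy ceiling** (kinematic transfer, any centre). If `g : ℝ³ → ℝ≥0∞` is
measurable and `∫_{ℝ²} g (R (y₀, y₁, c)) dy ≤ X` for every linear isometry `R` and height `c`, then
for every `x₀ ∈ ℝ³`

  `∫ g(x) / |x − x₀| dx ≤ 2π · X`.

(Average of the planar bound over the pencil of planes containing the vertical axis through
`x₀`; with `g = |u(t)|²`, the scale-invariant Hardy energy of `HardyPointSink.HardyEnergyBound` is
bounded by `2π` times the planar kinetic-energy ceiling of `PlaneEnergyCeiling.PlanarEnergyAPriori`.) -/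
theorem lintegral_div_enorm_sub_le_of_planar {g : EuclideanSpace ℝ (Fin 3) → ℝ≥0∞}
    (hg : Measurable g) {X : ℝ≥0∞}
    (hX : ∀ (R : EuclideanSpace ℝ (Fin 3) ≃ₗᵢ[ℝ] EuclideanSpace ℝ (Fin 3)) (c : ℝ),
      ∫⁻ y : EuclideanSpace ℝ (Fin 2), g (R (toLp 2 ![y 0, y 1, c])) ≤ X)
    (x₀ : EuclideanSpace ℝ (Fin 3)) :
    ∫⁻ x, g x / ‖x - x₀‖ₑ ≤ ENNReal.ofReal (2 * π) * X := by
  have h := lintegral_div_enorm_le_of_planar (g := fun x => g (x + x₀)) (hg.comp (measurable_add_const x₀))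
    (planarBound_translate hX x₀)
  calc ∫⁻ x, g x / ‖x - x₀‖ₑ = ∫⁻ x, g (x + x₀) / ‖x‖ₑ := by
        rw [← lintegral_add_right_eq_self (fun x => g x / ‖x - x₀‖ₑ) x₀]
        simp only [add_sub_cancel_right]
    _ ≤ ENNReal.ofReal (2 * π) * X := h

/-- **Registered anchor `planarToHardy` (closed form of `lintegral_div_enorm_sub_le_of_planar`).**
For measurable `g : ℝ³ → ℝ≥0∞` whose planar integrals over all planes `R({x₂ = c})` are `≤ X`,
the scale-invariant Hardy energy at every centre is bounded: `∫ g(x)/|x − x₀| dx ≤ 2π X`. -/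
theorem planarToHardy : ∀ (g : EuclideanSpace ℝ (Fin 3) → ENNReal), Measurable g → ∀ (X : ENNReal), (∀ (R : EuclideanSpace ℝ (Fin 3) ≃ₗᵢ[ℝ] EuclideanSpace ℝ (Fin 3)) (c : ℝ), ∫⁻ y : EuclideanSpace ℝ (Fin 2), g (R (WithLp.toLp 2 ![y 0, y 1, c])) ≤ X) → ∀ (x₀ : EuclideanSpace ℝ (Fin 3)), ∫⁻ x, g x / ‖x - x₀‖ₑ ≤ ENNReal.ofReal (2 * Real.pi) * X :=
  fun _ hg _ hX x₀ => lintegral_div_enorm_sub_le_of_planar hg hX x₀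

end Summit.NavierStokesRegularity.NavierStokesRegularity.Theorems.PlanarEnergyAPriori

end
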